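import Mathlib
import Literature.NumberTheory.LFunctions.Zhang2022.Section14Prop141OfLegs
import Literature.NumberTheory.LFunctions.Zhang2022.Section14Eq146W
import Literature.NumberTheory.LFunctions.Zhang2022.Section14Eq145Discharge
import HarnessLib

/-!
# Zhang (2022) §14: Proposition 14.1 and its `β = 0` chain of record from the FOUR remaining
# window estimates (W-leg1, W-leg2 at modulus `Dk`; leg1₂, leg2₂ at modulus `D₂k`) — by-name corollaries

Topic `Literature/NumberTheory/LFunctions/Zhang2022` (Landau–Siegel audit tree; verdict-neutral; leaf
`Skeleton.Prop141`, rows G-L3t7-1 / G-adj2-4 of the ZHANG-L discharge lane, WP14-PLAN v1 §2/§4).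
Y. Zhang, *Discrete mean estimates and the Landau–Siegel zero*, arXiv:2211.02515v1 (2022)
[Zhang2022LandauSiegel] — **an unrefereed manuscript under adjudication**; this file PROVES implications
only; it asserts none of the four estimates and says nothing about Theorems 1–2 of the manuscript or
about Landau–Siegel zeros.

After the landings of 2026-08-26 (u004→u010 `step14u010_holds`, (14.7) `eq147_holds`, u013
`step14u013a/b_holds`, u015 `step14u015_holds`, (14.3)/(14.3)ᵂ `Eq143.eq143_holds`/`eq143W`, u017 on the
closed conductor range `lhs148_le_rhs1417On_closed` / `eq148W_of_legs_closed`, the (14.6) reduction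
`eq146W_of_legs` / `eq146_of_legsW`, and the general-`β` assembly `prop141_of_legs`), the leaf
`Skeleton.Prop141` and every `β = 0` node of the printed chain depend on exactly FOUR window estimates of
one type ("for `1 < r < D³` … Lemma 5.6; for `D³ ≤ r < 2DP₄` … the large sieve inequality", §14 p.79,
tex L3960–L3963, with the twist `(pt₀)^β` inside the `p`-sum): W-leg1 / W-leg2 (modulus `Dk`, the u017
majorant `rhs1417OnW` on the two halves of the closed range `1 < r ≤ 2DP₄`) and leg1₂ / leg2₂ (the same
at modulus `D₂k`, `D = D₁D₂`, `D₁ > 1`, coefficients `κ*(D₁d·)`). This file records that dependency as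
kernel-checked corollaries BY NAME, so that the closers' files are estimate-only:

* `eq148_of_legsW` — (14.8) `Typed.Sec14.Eq148` from W-leg1 + W-leg2 (instance `β = 0` of
  `eq148W_of_legs_closed`, `‖0‖ < 5α`, `lhs148W χ 0 = lhs148 χ`);
* `eq145_of_legsW` — (14.5) `Typed.Sec14.Eq145` (then `dedEq145_holds` with the tree's (14.7), u013, u015);
* `prop141Zero_of_four` — Proposition 14.1 at `β = 0` (`Typed.Sec14.Prop141Zero`, the printed proof's
  case) from the four estimates (`prop141Zero_of_eq145_eq146` ∘ `eq146_of_legsW`);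
* `prop141_of_four` — the leaf `Skeleton.Prop141` (every `|β| < 5α`) from the four estimates
  (`prop141_of_legs` ∘ `eq146W_of_legs`).

No new definition, no new claim.

## References

* Y. Zhang, arXiv:2211.02515v1 (2022), §14 pp. 76–79, Prop. 14.1, (14.3)–(14.8).
  [cite: Zhang2022LandauSiegel, §14 Prop. 14.1 (proof) pp.76–79, tex L3836–L3969]
-/

noncomputable section

open Complex Real

namespace Literature.NumberTheory.LFunctions.Zhang2022.Typed.Sec14

open Skeleton DirichletCharacter

/-- **(14.8) from W-leg1 + W-leg2** (§14 p.79, tex L3945–L3963): the typed (14.8) `Typed.Sec14.Eq148`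
(`lhs148 ≪ P²D^{−c}`) is the `β = 0` instance of the twisted (14.8) delivered by `eq148W_of_legs_closed`
from the two `r`-range estimates on the closed conductor range (`‖(0 : ℂ)‖ < 5α` as `α = π/𝓛⁹ > 0`,
`lhs148W χ 0 = lhs148 χ`). [cite: Zhang2022LandauSiegel, §14 (14.8) p.79, tex L3945–L3963] -/
theorem eq148_of_legsW
    (hleg1 : ∀ B : ℝ, ∃ c : ℝ, 0 < c ∧ ∃ C : ℝ, ForAllLarge fun D _ χ => AssumptionA D χ →
      ∀ β : ℂ, ‖β‖ < 5 * alpha D → ∀ κs as : ℕ → ℂ, Eq141 B κs → Eq142 D B as →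
        rhs1417OnW χ β κs ((Finset.Icc 2 ⌊2 * (D : ℝ) * P4 D⌋₊).filter (fun r => r < D ^ 3))
          ≤ C * bigP D ^ 2 * (D : ℝ) ^ (-c))
    (hleg2 : ∀ B : ℝ, ∃ c : ℝ, 0 < c ∧ ∃ C : ℝ, ForAllLarge fun D _ χ => AssumptionA D χ →
      ∀ β : ℂ, ‖β‖ < 5 * alpha D → ∀ κs as : ℕ → ℂ, Eq141 B κs → Eq142 D B as →
        rhs1417OnW χ β κs ((Finset.Icc 2 ⌊2 * (D : ℝ) * P4 D⌋₊).filter (fun r => ¬ r < D ^ 3))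
          ≤ C * bigP D ^ 2 * (D : ℝ) ^ (-c)) :
    Eq148 := by
  intro B
  obtain ⟨c, hc, C, D₀, h⟩ := eq148W_of_legs_closed hleg1 hleg2 B
  refine ⟨c, hc, C, max D₀ 2, fun D _ χ hD hq hp hA κs as hκ ha => ?_⟩
  have hD₀ : D₀ ≤ D := le_trans (le_max_left _ _) hD
  have hD2 : (2 : ℝ) ≤ D := by exact_mod_cast le_trans (le_max_right _ _) hD
  have hα : 0 < alpha D := by
    have hℓ : 0 < ell D := Real.log_pos (by linarith)
    rw [alpha, bigP, Real.log_exp]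
    exact div_pos Real.pi_pos (pow_pos hℓ 9)
  have hβ : ‖(0 : ℂ)‖ < 5 * alpha D := by rw [norm_zero]; positivity
  have key := h D χ hD₀ hq hp hA 0 hβ κs as hκ ha
  rwa [lhs148W_zero] at key

/-- **(14.5) from W-leg1 + W-leg2** (§14 pp.78–79): `Typed.Sec14.Eq145` by the tree's deduction node
`dedEq145_holds` ((14.7) `eq147_holds`, u013 `step14u013a_holds`/`step14u013b_holds`, u015
`step14u015_holds`) and (14.8) `eq148_of_legsW`. [cite: Zhang2022LandauSiegel, §14 (14.5) (proof) pp.78–79, tex L3918–L3963] -/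
theorem eq145_of_legsW
    (hleg1 : ∀ B : ℝ, ∃ c : ℝ, 0 < c ∧ ∃ C : ℝ, ForAllLarge fun D _ χ => AssumptionA D χ →
      ∀ β : ℂ, ‖β‖ < 5 * alpha D → ∀ κs as : ℕ → ℂ, Eq141 B κs → Eq142 D B as →
        rhs1417OnW χ β κs ((Finset.Icc 2 ⌊2 * (D : ℝ) * P4 D⌋₊).filter (fun r => r < D ^ 3))
          ≤ C * bigP D ^ 2 * (D : ℝ) ^ (-c))
    (hleg2 : ∀ B : ℝ, ∃ c : ℝ, 0 < c ∧ ∃ C : ℝ, ForAllLarge fun D _ χ => AssumptionA D χ →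
      ∀ β : ℂ, ‖β‖ < 5 * alpha D → ∀ κs as : ℕ → ℂ, Eq141 B κs → Eq142 D B as →
        rhs1417OnW χ β κs ((Finset.Icc 2 ⌊2 * (D : ℝ) * P4 D⌋₊).filter (fun r => ¬ r < D ^ 3))
          ≤ C * bigP D ^ 2 * (D : ℝ) ^ (-c)) :
    Eq145 :=
  dedEq145_holds eq147_holds step14u013a_holds step14u013b_holds step14u015_holds
    (eq148_of_legsW hleg1 hleg2)

/-- **Proposition 14.1 at `β = 0` from the four window estimates** ("We prove this proposition with
`β = 0` only", §14 p.76): `Typed.Sec14.Prop141Zero` by `prop141Zero_of_eq145_eq146` ((14.3) and u010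
tree theorems inside) from (14.5) `eq145_of_legsW` (W-leg1, W-leg2) and (14.6) `eq146_of_legsW`
(leg1₂, leg2₂ at modulus `D₂k`). [cite: Zhang2022LandauSiegel, §14 Prop. 14.1 (proof) pp.76–79, tex L3849–L3969] -/
theorem prop141Zero_of_four
    (hleg1 : ∀ B : ℝ, ∃ c : ℝ, 0 < c ∧ ∃ C : ℝ, ForAllLarge fun D _ χ => AssumptionA D χ →
      ∀ β : ℂ, ‖β‖ < 5 * alpha D → ∀ κs as : ℕ → ℂ, Eq141 B κs → Eq142 D B as →
        rhs1417OnW χ β κs ((Finset.Icc 2 ⌊2 * (D : ℝ) * P4 D⌋₊).filter (fun r => r < D ^ 3))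
          ≤ C * bigP D ^ 2 * (D : ℝ) ^ (-c))
    (hleg2 : ∀ B : ℝ, ∃ c : ℝ, 0 < c ∧ ∃ C : ℝ, ForAllLarge fun D _ χ => AssumptionA D χ →
      ∀ β : ℂ, ‖β‖ < 5 * alpha D → ∀ κs as : ℕ → ℂ, Eq141 B κs → Eq142 D B as →
        rhs1417OnW χ β κs ((Finset.Icc 2 ⌊2 * (D : ℝ) * P4 D⌋₊).filter (fun r => ¬ r < D ^ 3))
          ≤ C * bigP D ^ 2 * (D : ℝ) ^ (-c))
    (hleg1₂ : ∀ B : ℝ, ∃ c : ℝ, 0 < c ∧ ∃ C : ℝ, ForAllLarge fun D _ χ => AssumptionA D χ →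
      ∀ β : ℂ, ‖β‖ < 5 * alpha D → ∀ κs as : ℕ → ℂ, Eq141 B κs → Eq142 D B as →
        ∀ D₁ D₂ : ℕ, D₁ * D₂ = D → 1 < D₁ →
          ∑ d ∈ Finset.Icc 1 ⌊2 * P4 D⌋₊, (d : ℝ)⁻¹ *
            ∑ r ∈ (Finset.Icc 2 ⌊2 * (D₂ : ℝ) * P4 D⌋₊).filter (fun r => r < D ^ 3),
              ∑ h ∈ (Finset.Ico 1 ⌈bigP D / r⌉₊).filter (fun h => D₂ / Nat.gcd D₂ r ∣ h),
                (D₂ : ℝ) / ((Nat.totient (h * r) : ℝ) * h * Real.sqrt r) *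
                  ∑ θ' ∈ finsetOf {θ' : DirichletCharacter ℂ r | θ'.IsPrimitive ∧
                      changeLevel (dvd_mul_left r D) θ' ≠ changeLevel (dvd_mul_right D r) χ},
                    ‖∑' l : ℕ, if Nat.Coprime l h then κs (D₁ * d * l) * θ' (l : ZMod r) *
                        ∑ p ∈ primeWindow D, χ (p : ZMod D) * θ'⁻¹ (p : ZMod r) * wt D β p *
                        DeltaW D ((l : ℝ) / ((p : ℝ) * h * r)) else 0‖
          ≤ C * bigP D ^ 2 * (D : ℝ) ^ (-c))
    (hleg2₂ : ∀ B : ℝ, ∃ c : ℝ, 0 < c ∧ ∃ C : ℝ, ForAllLarge fun D _ χ => AssumptionA D χ →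
      ∀ β : ℂ, ‖β‖ < 5 * alpha D → ∀ κs as : ℕ → ℂ, Eq141 B κs → Eq142 D B as →
        ∀ D₁ D₂ : ℕ, D₁ * D₂ = D → 1 < D₁ →
          ∑ d ∈ Finset.Icc 1 ⌊2 * P4 D⌋₊, (d : ℝ)⁻¹ *
            ∑ r ∈ (Finset.Icc 2 ⌊2 * (D₂ : ℝ) * P4 D⌋₊).filter (fun r => ¬ r < D ^ 3),
              ∑ h ∈ (Finset.Ico 1 ⌈bigP D / r⌉₊).filter (fun h => D₂ / Nat.gcd D₂ r ∣ h),
                (D₂ : ℝ) / ((Nat.totient (h * r) : ℝ) * h * Real.sqrt r) *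
                  ∑ θ' ∈ finsetOf {θ' : DirichletCharacter ℂ r | θ'.IsPrimitive ∧
                      changeLevel (dvd_mul_left r D) θ' ≠ changeLevel (dvd_mul_right D r) χ},
                    ‖∑' l : ℕ, if Nat.Coprime l h then κs (D₁ * d * l) * θ' (l : ZMod r) *
                        ∑ p ∈ primeWindow D, χ (p : ZMod D) * θ'⁻¹ (p : ZMod r) * wt D β p *
                        DeltaW D ((l : ℝ) / ((p : ℝ) * h * r)) else 0‖
          ≤ C * bigP D ^ 2 * (D : ℝ) ^ (-c)) :
    Prop141Zero :=
  prop141Zero_of_eq145_eq146 (eq145_of_legsW hleg1 hleg2) (eq146_of_legsW hleg1₂ hleg2₂)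

/-- **The leaf `Skeleton.Prop141` from the four window estimates** (Proposition 14.1 for every
`|β| < 5α`, §14 p.76; "the general case is almost identical"): `prop141_of_legs` (W-leg1, W-leg2, and
(14.6)ᵂ) with (14.6)ᵂ supplied by `eq146W_of_legs` from leg1₂, leg2₂. With this the leaf's remaining
inputs are exactly the four estimates of WP14-PLAN v1 §2 (CORE-small / CORE-large at `N = D` and
`N = D₂`). [cite: Zhang2022LandauSiegel, §14 Prop. 14.1 (proof) pp.76–79, tex L3836–L3969] -/
theorem prop141_of_four
    (hleg1 : ∀ B : ℝ, ∃ c : ℝ, 0 < c ∧ ∃ C : ℝ, ForAllLarge fun D _ χ => AssumptionA D χ →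
      ∀ β : ℂ, ‖β‖ < 5 * alpha D → ∀ κs as : ℕ → ℂ, Eq141 B κs → Eq142 D B as →
        rhs1417OnW χ β κs ((Finset.Icc 2 ⌊2 * (D : ℝ) * P4 D⌋₊).filter (fun r => r < D ^ 3))
          ≤ C * bigP D ^ 2 * (D : ℝ) ^ (-c))
    (hleg2 : ∀ B : ℝ, ∃ c : ℝ, 0 < c ∧ ∃ C : ℝ, ForAllLarge fun D _ χ => AssumptionA D χ →
      ∀ β : ℂ, ‖β‖ < 5 * alpha D → ∀ κs as : ℕ → ℂ, Eq141 B κs → Eq142 D B as →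
        rhs1417OnW χ β κs ((Finset.Icc 2 ⌊2 * (D : ℝ) * P4 D⌋₊).filter (fun r => ¬ r < D ^ 3))
          ≤ C * bigP D ^ 2 * (D : ℝ) ^ (-c))
    (hleg1₂ : ∀ B : ℝ, ∃ c : ℝ, 0 < c ∧ ∃ C : ℝ, ForAllLarge fun D _ χ => AssumptionA D χ →
      ∀ β : ℂ, ‖β‖ < 5 * alpha D → ∀ κs as : ℕ → ℂ, Eq141 B κs → Eq142 D B as →
        ∀ D₁ D₂ : ℕ, D₁ * D₂ = D → 1 < D₁ →
          ∑ d ∈ Finset.Icc 1 ⌊2 * P4 D⌋₊, (d : ℝ)⁻¹ *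
            ∑ r ∈ (Finset.Icc 2 ⌊2 * (D₂ : ℝ) * P4 D⌋₊).filter (fun r => r < D ^ 3),
              ∑ h ∈ (Finset.Ico 1 ⌈bigP D / r⌉₊).filter (fun h => D₂ / Nat.gcd D₂ r ∣ h),
                (D₂ : ℝ) / ((Nat.totient (h * r) : ℝ) * h * Real.sqrt r) *
                  ∑ θ' ∈ finsetOf {θ' : DirichletCharacter ℂ r | θ'.IsPrimitive ∧
                      changeLevel (dvd_mul_left r D) θ' ≠ changeLevel (dvd_mul_right D r) χ},
                    ‖∑' l : ℕ, if Nat.Coprime l h then κs (D₁ * d * l) * θ' (l : ZMod r) *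
                        ∑ p ∈ primeWindow D, χ (p : ZMod D) * θ'⁻¹ (p : ZMod r) * wt D β p *
                        DeltaW D ((l : ℝ) / ((p : ℝ) * h * r)) else 0‖
          ≤ C * bigP D ^ 2 * (D : ℝ) ^ (-c))
    (hleg2₂ : ∀ B : ℝ, ∃ c : ℝ, 0 < c ∧ ∃ C : ℝ, ForAllLarge fun D _ χ => AssumptionA D χ →
      ∀ β : ℂ, ‖β‖ < 5 * alpha D → ∀ κs as : ℕ → ℂ, Eq141 B κs → Eq142 D B as →
        ∀ D₁ D₂ : ℕ, D₁ * D₂ = D → 1 < D₁ →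
          ∑ d ∈ Finset.Icc 1 ⌊2 * P4 D⌋₊, (d : ℝ)⁻¹ *
            ∑ r ∈ (Finset.Icc 2 ⌊2 * (D₂ : ℝ) * P4 D⌋₊).filter (fun r => ¬ r < D ^ 3),
              ∑ h ∈ (Finset.Ico 1 ⌈bigP D / r⌉₊).filter (fun h => D₂ / Nat.gcd D₂ r ∣ h),
                (D₂ : ℝ) / ((Nat.totient (h * r) : ℝ) * h * Real.sqrt r) *
                  ∑ θ' ∈ finsetOf {θ' : DirichletCharacter ℂ r | θ'.IsPrimitive ∧
                      changeLevel (dvd_mul_left r D) θ' ≠ changeLevel (dvd_mul_right D r) χ},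
                    ‖∑' l : ℕ, if Nat.Coprime l h then κs (D₁ * d * l) * θ' (l : ZMod r) *
                        ∑ p ∈ primeWindow D, χ (p : ZMod D) * θ'⁻¹ (p : ZMod r) * wt D β p *
                        DeltaW D ((l : ℝ) / ((p : ℝ) * h * r)) else 0‖
          ≤ C * bigP D ^ 2 * (D : ℝ) ^ (-c)) :
    Prop141 :=
  prop141_of_legs hleg1 hleg2 (eq146W_of_legs hleg1₂ hleg2₂)

end Literature.NumberTheory.LFunctions.Zhang2022.Typed.Sec14
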